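import Mathlib
import Summits.Schanuel.Schanuel.Theses.RigidCore
import Summits.Schanuel.Schanuel.Theorems.RigidCoreMinimalCounterexampleInAclCorankOne
import Summits.Schanuel.Schanuel.Theorems.RigidCoreMinimalCounterexampleInAclCorankGeTwoLogPart
import Summits.Schanuel.Schanuel.Theorems.RigidCoreMinimalCounterexampleInAclCorankGeTwoHitSetRingDefinable
import Summits.Schanuel.Schanuel.Theorems.RigidCoreMinimalCounterexampleInAclCosetLineSparsityOfFree
import Summits.Schanuel.Schanuel.Theorems.RigidCoreMinimalCounterexampleInAclMonomialSliceVariety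
import Summits.Schanuel.Schanuel.Theorems.RigidCoreMinimalCounterexampleInAclLineVarietyDeadDirections
import Summits.Schanuel.Schanuel.Theorems.RigidCoreMinimalCounterexampleInAclNoFullLineOfCosetLineSparsity

/-!
# (S*) and item 14744 MODULO FREE COSET-LINE SPARSITY — crux stmt-Schanuel-0969 `RigidCore.MinimalCounterexampleInAcl`

Line `kernel-arithmetic-selection` (lead prover-line-stmt-Schanuel-0969-c16-0), `--supports stmt-Schanuel-0969`; registered stubs
`stub_crux_iff_residues_of_fcsPlus` and `stub_geThree_iff_relResidue_of_fcsPlus` of the gen-32 skeleton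
(`Cruxes/MinimalCounterexampleInAcl/Lines/kernel_arithmetic_selection.lean`).

After gens 1–31 of the line, the open content of the crux (S*) — "every first-failure counterexample to Schanuel's conjecture has all its
coordinates in `acl^{ℂ_exp}(∅)`" — is EXACTLY three named research statements, and this file records the two resulting equivalences as
tree theorems:

* FCS⁺ `FreeCosetLineSparsity` shape (stub `stub_freeCosetLineSparsity`, OPEN; Zilber–Pink type for the exponential graph): a fibre-finite
  coset family of ℚ-linearly independent exponential points on a Zariski closed `W ⊆ ℂ^ι × ℂ^ι` with `dim W + rank Λ < #ι`, free modulo the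
  dead lattice `Λ` along positive-density sub-families, has upper Banach density zero.  By the landed reduction (R1
  `stub_cosetLineSparsity_of_free`, R2α `stub_monomialSliceVariety`, R2β `stub_lineVariety_deadDirections`, R3
  `stub_noFullLine_of_cosetLineSparsity`) FCS⁺ gives S7b (no full line of mates in a log direction at corank ≥ 2,
  `corankGeTwo_noFullLine_of_fcsPlus`), hence with the tree theorem S7a (`stub_corankGeTwo_hitSetRingDefinable`) the log coordinates of
  every corank ≥ 2 first failure are in `acl(∅)`.
* R₃ (stub `stub_pureTwistedResidue`, OPEN; ⟸ crux stmt-0971 `SparsityTwo`): the pure gadget-generic rank-2 residue.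
* S7′ (stub `stub_corankGeTwo_relResidue`, OPEN; ⟸ uniform finiteness of the relative pure fibres): relative pure isolation at corank ≥ 2.

THEOREMS (no conditional proof-of-item is stated here; the compositions live in the line skeleton): `stub_crux_iff_residues_of_fcsPlus` — FCS⁺ ⟹ ((S*) ⟺ R₃ ∧ S7′); `stub_geThree_iff_relResidue_of_fcsPlus` — FCS⁺ ⟹
(item stmt-14744 `MinimalCounterexampleInAclGeThree` ⟺ S7′).  (⇒: R₃ and S7′ are special cases; ⇐: `corankGeTwo_of_pieces` +
`crux_of_pureTwistedResidue_of_corankGeTwo` / `geThree_iff_corankGeTwo`, Theorems/…CorankGeTwoLogPart and …CorankOne.)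

References: status note `Cruxes/MinimalCounterexampleInAcl/Lines/kernel_arithmetic_selection.md` §Addendum c16; obstruction note
`Cruxes/MinimalCounterexampleInAcl/Lines/kernel_arithmetic_selection_S7b_obstruction.md` §5; [Kirby2010] J. Kirby, *Exponential algebraicity in
exponential fields*, Bull. LMS 42 (2010), Prop. 7.2.
-/

noncomputable section

set_option linter.dupNamespace false

open Complex Set

namespace Summit.Schanuel.Schanuel.Cruxes.MinimalCounterexampleInAcl.KernelArithmeticSelection

open Summit.Schanuel.Schanuel.Theorems.AclSubsetLogFreeCore.Negative

/-- **S7b FROM FCS⁺** (curried): free coset-line sparsity modulo dead directions gives "no full line of mates in a log direction at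
corank ≥ 2", through the landed R3 ∘ (R1, R2β ∘ R2α). [cite: Kirby2010, Prop. 7.2] -/
theorem corankGeTwo_noFullLine_of_fcsPlus (hF : ∀ (ι : Type) [Fintype ι] (i₀ : ι) (W : Set (ι ⊕ ι → ℂ)) (c : ℂ) (J : Set ℤ) (q : ℤ → ι → ℂ) (Λ : Submodule ℤ (ι → ℤ)), Literature.NumberTheory.Transcendental.IsZariskiClosed ℂ W → Literature.NumberTheory.Transcendental.zariskiDim ℂ W + ((Module.finrank ℤ ↥Λ : ℕ) : WithBot ℕ∞) < ((Fintype.card ι : ℕ) : WithBot ℕ∞) → (∀ j ∈ J, LinearIndependent ℚ (q j) ∧ Sum.elim (q j) (Complex.exp ∘ q j) ∈ W ∧ q j i₀ = c + 2 * ↑Real.pi * Complex.I * (j : ℂ)) → (∀ ω : ι → ℂ, Set.Finite {j : ℤ | j ∈ J ∧ Complex.exp ∘ q j = ω}) → (∀ M ∈ Λ, ∀ j ∈ J, ∀ j' ∈ J, (∑ i, (M i : ℂ) * q j i) = ∑ i, (M i : ℂ) * q j' i) → (∀ J' ⊆ J, (∃ δ : ℝ, 0 < δ ∧ ∀ N₀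 : ℕ, ∃ N : ℕ, N₀ ≤ N ∧ ∃ a : ℤ, δ * (N : ℝ) ≤ (Set.ncard {j : ℤ | j ∈ Finset.Ico a (a + (N : ℤ)) ∧ j ∈ J'} : ℝ)) → ∀ M : ι → ℤ, (∀ m : ℤ, m ≠ 0 → m • M ∉ Λ) → Set.Infinite ((fun j => ∑ i, (M i : ℂ) * q j i) '' J')) → ∀ δ : ℝ, 0 < δ → ∃ N₀ : ℕ, ∀ N : ℕ, N₀ ≤ N → ∀ a : ℤ, (Set.ncard {j : ℤ | j ∈ Finset.Ico a (a + (N : ℤ)) ∧ j ∈ J} : ℝ) < δ * (N : ℝ)) : ∀ (n r : ℕ), 3 ≤ n → r + 2 ≤ n → ∀ (x : Fin n → ℂ), x ∈ Summit.Schanuel.Schanuel.Cruxes.MinimalCounterexampleInAcl.KernelArithmeticSelection.firstFailures n → (∀ i : Fin n, (i : ℕ) < r → IsAlgebraic ℚ (Complex.exp (x i))) → (∀ M : Fin n → ℤ, (∃ i : Fin n, r ≤ (i : ℕ) ∧ M i ≠ 0) → Transcendental ℚ (Complex.exp (∑ i, (M i : ℂ) * x i))) → ∀ μ : Fin n → ℤ,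 (∀ i : Fin n, r ≤ (i : ℕ) → μ i = 0) → μ ≠ 0 → ∃ j : ℤ, ¬ ∃ x' ∈ Summit.Schanuel.Schanuel.Cruxes.MinimalCounterexampleInAcl.KernelArithmeticSelection.locusMates x, ∀ i : Fin n, (i : ℕ) < r → x' i = x i + 2 * ↑Real.pi * Complex.I * ((j • μ) i : ℂ) :=
  stub_noFullLine_of_cosetLineSparsity (stub_cosetLineSparsity_of_free hF)
    (stub_lineVariety_deadDirections stub_monomialSliceVariety)

/-- **The corank ≥ 2 sector of (S*) from FCS⁺ and S7′** (S7a is the tree theorem `stub_corankGeTwo_hitSetRingDefinable`; composition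
`corankGeTwo_of_pieces`). [cite: Kirby2010, Prop. 7.2] -/
theorem corankGeTwo_of_fcsPlus_of_relResidue (hF : ∀ (ι : Type) [Fintype ι] (i₀ : ι) (W : Set (ι ⊕ ι → ℂ)) (c : ℂ) (J : Set ℤ) (q : ℤ → ι → ℂ) (Λ : Submodule ℤ (ι → ℤ)), Literature.NumberTheory.Transcendental.IsZariskiClosed ℂ W → Literature.NumberTheory.Transcendental.zariskiDim ℂ W + ((Module.finrank ℤ ↥Λ : ℕ) : WithBot ℕ∞) < ((Fintype.card ι : ℕ) : WithBot ℕ∞) → (∀ j ∈ J, LinearIndependent ℚ (q j) ∧ Sum.elim (q j) (Complex.exp ∘ q j) ∈ W ∧ q j i₀ = c + 2 * ↑Real.pi * Complex.I * (j : ℂ)) → (∀ ω : ι → ℂ, Set.Finite {j : ℤ | j ∈ J ∧ Complex.exp ∘ q j = ω}) → (∀ M ∈ Λ, ∀ j ∈ J, ∀ j' ∈ J, (∑ i, (M i : ℂ) * q j i) = ∑ i, (M i : ℂ) * q j' i) → (∀ J' ⊆ J, (∃ δ : ℝ, 0 < δ ∧ ∀ N₀ : ℕ, ∃ N : ℕ,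 N₀ ≤ N ∧ ∃ a : ℤ, δ * (N : ℝ) ≤ (Set.ncard {j : ℤ | j ∈ Finset.Ico a (a + (N : ℤ)) ∧ j ∈ J'} : ℝ)) → ∀ M : ι → ℤ, (∀ m : ℤ, m ≠ 0 → m • M ∉ Λ) → Set.Infinite ((fun j => ∑ i, (M i : ℂ) * q j i) '' J')) → ∀ δ : ℝ, 0 < δ → ∃ N₀ : ℕ, ∀ N : ℕ, N₀ ≤ N → ∀ a : ℤ, (Set.ncard {j : ℤ | j ∈ Finset.Ico a (a + (N : ℤ)) ∧ j ∈ J} : ℝ) < δ * (N : ℝ)) (hS : ∀ (n r : ℕ), 3 ≤ n → r + 2 ≤ n → ∀ (x : Fin n → ℂ), x ∈ Summit.Schanuel.Schanuel.Cruxes.MinimalCounterexampleInAcl.KernelArithmeticSelection.firstFailures n → (∀ i : Fin n, (i : ℕ) < r → IsAlgebraic ℚ (Complex.exp (x i))) → (∀ M : Fin n → ℤ, (∃ i : Fin n, r ≤ (i : ℕ) ∧ M i ≠ 0) → Transcendental ℚ (Complex.exp (∑ i, (M i : ℂ) * x i))) → (∀ i : Fin n, (i : ℕ) < r → x i ∈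 Summit.Schanuel.Schanuel.Theorems.AclSubsetLogFreeCore.Negative.expAcl) → ∀ i, x i ∈ Summit.Schanuel.Schanuel.Theorems.AclSubsetLogFreeCore.Negative.expAcl) : ∀ (n r : ℕ), 3 ≤ n → r + 2 ≤ n → ∀ (x : Fin n → ℂ), x ∈ Summit.Schanuel.Schanuel.Cruxes.MinimalCounterexampleInAcl.KernelArithmeticSelection.firstFailures n → (∀ i : Fin n, (i : ℕ) < r → IsAlgebraic ℚ (Complex.exp (x i))) → (∀ M : Fin n → ℤ, (∃ i : Fin n, r ≤ (i : ℕ) ∧ M i ≠ 0) → Transcendental ℚ (Complex.exp (∑ i, (M i : ℂ) * x i))) → ∀ i, x i ∈ Summit.Schanuel.Schanuel.Theorems.AclSubsetLogFreeCore.Negative.expAcl :=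
  corankGeTwo_of_pieces
    (fun n r hn hr x hx halg hpure =>
      @stub_corankGeTwo_hitSetRingDefinable n r hn hr x hx halg hpure (FirstOrder.Ring.compatibleRingOfRing ℤ))
    (corankGeTwo_noFullLine_of_fcsPlus hF) hS

/-- **Registered stub — item stmt-14744 ⟺ S7′ MODULO FCS⁺ (PROVED).**  Under free coset-line sparsity, (S*) in ranks ≥ 3
(`MinimalCounterexampleInAclGeThree`) is equivalent to the relative pure residue S7′ (⇒: special case; ⇐: `geThree_iff_corankGeTwo`).
[cite: Kirby2010, Prop. 7.2] -/
theorem stub_geThree_iff_relResidue_of_fcsPlus : (∀ (ι : Type) [Fintype ι] (i₀ : ι) (W : Set (ι ⊕ ι → ℂ)) (c : ℂ) (J : Set ℤ) (q : ℤ → ι → ℂ) (Λ : Submodule ℤ (ι → ℤ)), Literature.NumberTheory.Transcendental.IsZariskiClosed ℂ W → Literature.NumberTheory.Transcendental.zariskiDim ℂ W + ((Module.finrank ℤ ↥Λ : ℕ) : WithBot ℕ∞) < ((Fintype.card ι : ℕ) : WithBot ℕ∞) → (∀ j ∈ J, LinearIndependent ℚ (q j) ∧ Sum.elim (q j) (Complex.exp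 ∘ q j) ∈ W ∧ q j i₀ = c + 2 * ↑Real.pi * Complex.I * (j : ℂ)) → (∀ ω : ι → ℂ, Set.Finite {j : ℤ | j ∈ J ∧ Complex.exp ∘ q j = ω}) → (∀ M ∈ Λ, ∀ j ∈ J, ∀ j' ∈ J, (∑ i, (M i : ℂ) * q j i) = ∑ i, (M i : ℂ) * q j' i) → (∀ J' ⊆ J, (∃ δ : ℝ, 0 < δ ∧ ∀ N₀ : ℕ, ∃ N : ℕ, N₀ ≤ N ∧ ∃ a : ℤ, δ * (N : ℝ) ≤ (Set.ncard {j : ℤ | j ∈ Finset.Ico a (a + (N : ℤ)) ∧ j ∈ J'} : ℝ)) → ∀ M : ι → ℤ, (∀ m : ℤ, m ≠ 0 → m • M ∉ Λ) → Set.Infinite ((fun j => ∑ i, (M i : ℂ) * q j i) '' J')) → ∀ δ : ℝ, 0 < δ → ∃ N₀ : ℕ, ∀ N : ℕ, N₀ ≤ N → ∀ a : ℤ, (Set.ncard {j : ℤ | j ∈ Finset.Ico a (a + (N : ℤ)) ∧ j ∈ J} : ℝ) < δ * (N : ℝ)) → (Summit.Schanuel.Schanuel.Theses.RigidCore.MinimalCounterexampleInAclGeThree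 ↔ (∀ (n r : ℕ), 3 ≤ n → r + 2 ≤ n → ∀ (x : Fin n → ℂ), x ∈ Summit.Schanuel.Schanuel.Cruxes.MinimalCounterexampleInAcl.KernelArithmeticSelection.firstFailures n → (∀ i : Fin n, (i : ℕ) < r → IsAlgebraic ℚ (Complex.exp (x i))) → (∀ M : Fin n → ℤ, (∃ i : Fin n, r ≤ (i : ℕ) ∧ M i ≠ 0) → Transcendental ℚ (Complex.exp (∑ i, (M i : ℂ) * x i))) → (∀ i : Fin n, (i : ℕ) < r → x i ∈ Summit.Schanuel.Schanuel.Theorems.AclSubsetLogFreeCore.Negative.expAcl) → ∀ i, x i ∈ Summit.Schanuel.Schanuel.Theorems.AclSubsetLogFreeCore.Negative.expAcl)) := by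
  intro hF
  constructor
  · intro hG n _ hn _ x hx _ _ _ i
    exact hG n hn x hx.1 hx.2.1 hx.2.2 i
  · intro hS
    exact geThree_iff_corankGeTwo.2 (corankGeTwo_of_fcsPlus_of_relResidue hF hS)

/-- **Registered stub — (S*) ⟺ R₃ ∧ S7′ MODULO FCS⁺ (PROVED).**  Under free coset-line sparsity the crux is equivalent to the conjunction
of its two necessary pure-isolation residues (⇒: `crux_iff_pureTwistedResidue_and_corankGeTwo`; ⇐: `crux_of_pureTwistedResidue_of_corankGeTwo`
over `corankGeTwo_of_fcsPlus_of_relResidue`). [cite: Kirby2010, Prop. 7.2] -/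
theorem stub_crux_iff_residues_of_fcsPlus : (∀ (ι : Type) [Fintype ι] (i₀ : ι) (W : Set (ι ⊕ ι → ℂ)) (c : ℂ) (J : Set ℤ) (q : ℤ → ι → ℂ) (Λ : Submodule ℤ (ι → ℤ)), Literature.NumberTheory.Transcendental.IsZariskiClosed ℂ W → Literature.NumberTheory.Transcendental.zariskiDim ℂ W + ((Module.finrank ℤ ↥Λ : ℕ) : WithBot ℕ∞) < ((Fintype.card ι : ℕ) : WithBot ℕ∞) → (∀ j ∈ J, LinearIndependent ℚ (q j) ∧ Sum.elim (q j) (Complex.exp ∘ q j) ∈ W ∧ q j i₀ = c + 2 * ↑Real.pi * Complex.I * (j : ℂ)) → (∀ ω : ι → ℂ, Set.Finite {j : ℤ | j ∈ J ∧ Complex.exp ∘ q j = ω}) → (∀ M ∈ Λ, ∀ j ∈ J, ∀ j' ∈ J, (∑ i, (M i : ℂ) * q j i) = ∑ i, (M i : ℂ) * q j' i) → (∀ J' ⊆ J, (∃ δ : ℝ, 0 < δ ∧ ∀ N₀ : ℕ, ∃ N : ℕ, N₀ ≤ N ∧ ∃ a : ℤ, δ * (N : ℝ) ≤ (Set.ncard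 {j : ℤ | j ∈ Finset.Ico a (a + (N : ℤ)) ∧ j ∈ J'} : ℝ)) → ∀ M : ι → ℤ, (∀ m : ℤ, m ≠ 0 → m • M ∉ Λ) → Set.Infinite ((fun j => ∑ i, (M i : ℂ) * q j i) '' J')) → ∀ δ : ℝ, 0 < δ → ∃ N₀ : ℕ, ∀ N : ℕ, N₀ ≤ N → ∀ a : ℤ, (Set.ncard {j : ℤ | j ∈ Finset.Ico a (a + (N : ℤ)) ∧ j ∈ J} : ℝ) < δ * (N : ℝ)) → (Summit.Schanuel.Schanuel.Theses.RigidCore.MinimalCounterexampleInAcl ↔ ((∀ (x : Fin 2 → ℂ), x ∈ Summit.Schanuel.Schanuel.Cruxes.MinimalCounterexampleInAcl.KernelArithmeticSelection.firstFailures 2 → (∀ M : Fin 2 → ℤ, M ≠ 0 → Transcendental ℚ (Complex.exp (∑ i, (M i : ℂ) * x i))) → Transcendental ↥(IntermediateField.adjoin ℚ (Set.range x ∪ Set.range (Complex.exp ∘ x))) (Complex.exp (x 0 ^ 2)) → Transcendental ↥(IntermediateField.adjoin ℚ (Set.range x ∪ Set.range (Complex.exp ∘ x))) (Complex.exp (x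 0 * x 1)) → Transcendental ↥(IntermediateField.adjoin ℚ (Set.range x ∪ Set.range (Complex.exp ∘ x))) (Complex.exp (x 1 ^ 2)) → Transcendental ↥(IntermediateField.adjoin ℚ (Set.range x ∪ Set.range (Complex.exp ∘ x))) (Complex.exp (Complex.I * x 0)) → Transcendental ↥(IntermediateField.adjoin ℚ (Set.range x ∪ Set.range (Complex.exp ∘ x))) (Complex.exp (Complex.I * x 1)) → ∀ i, x i ∈ Summit.Schanuel.Schanuel.Theorems.AclSubsetLogFreeCore.Negative.expAcl) ∧ (∀ (n r : ℕ), 3 ≤ n → r + 2 ≤ n → ∀ (x : Fin n → ℂ), x ∈ Summit.Schanuel.Schanuel.Cruxes.MinimalCounterexampleInAcl.KernelArithmeticSelection.firstFailures n → (∀ i : Fin n, (i : ℕ) < r → IsAlgebraic ℚ (Complex.exp (x i))) → (∀ M : Fin n → ℤ, (∃ i : Fin n, r ≤ (i : ℕ) ∧ M i ≠ 0) → Transcendental ℚ (Complex.exp (∑ i, (M i : ℂ) * x i))) → (∀ i : Fin n, (i : ℕ) < r → x i ∈ Summit.Schanuel.Schanuel.Theorems.AclSubsetLogFreeCore.Negative.expAcl)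 → ∀ i, x i ∈ Summit.Schanuel.Schanuel.Theorems.AclSubsetLogFreeCore.Negative.expAcl))) := by
  intro hF
  constructor
  · intro h
    have h2 := crux_iff_pureTwistedResidue_and_corankGeTwo.1 h
    exact ⟨h2.1, fun n r hn hr x hx halg hpure _ => h2.2 n r hn hr x hx halg hpure⟩
  · rintro ⟨hR, hS⟩
    exact crux_of_pureTwistedResidue_of_corankGeTwo hR (corankGeTwo_of_fcsPlus_of_relResidue hF hS)

end Summit.Schanuel.Schanuel.Cruxes.MinimalCounterexampleInAcl.KernelArithmeticSelection

end
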